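import Mathlib
import Summits.Ventures.PercRepro.TriangleCapHungK3

/-!
# PercRepro — THE HUNG `K_{4,k−5}` (`HungK4`): a vertex of degree `2` on an edge of `K_{4,k−5}` lies on the cell
`(k, 4, 2)` at the non-bipartite second-best value `m k − 2 (k − 3) − 2 (k − 9)` and is `4`-bipartite for no `A`;
and the cap of the cell with every degree `≥ 4` makes `D` `4`-bipartite (p3, gen 45; part 201a)

`hungK4_value`: the cell, the value, never `BipSub` (the triangle `z x y`). `four_two_cap_strict` (`k ≥ 11`, every
degree `≥ 4`): the count of part 198a leaves `M ≤ 1`, and `M = 1` is impossible — a matched `y` of degree `≥ 4` has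
`g(y) ≥ 2`, its partner too, but `g(y) + g(y′) ≤ |R| = 3`. Axioms: standard.
-/

namespace PercRepro

namespace TriangleCap

namespace C047

open Finset

variable {V : Type*} [Fintype V] [DecidableEq V]

/-- **THE HUNG `K_{4,k−5}`:** a vertex `z` of degree `2` whose deletion is `K_{4,k−5}` (a spanning subgraph of
`K(A, Aᶜ)`, `|A| = 4`, with `4 (k − 5)` edges), the two neighbours of `z` on opposite sides. -/
def HungK4 (D : SimpleGraph V) [DecidableRel D.Adj] : Prop :=
  ∃ (z : V) (A : Finset {v : V // v ≠ z}), deg D z = 2 ∧ A.card = 4 ∧ BipSub (del D z) A ∧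
    (del D z).edgeFinset.card = 4 * (Fintype.card {v : V // v ≠ z} - 4) ∧
    ∃ x y : {v : V // v ≠ z}, x ∈ A ∧ y ∉ A ∧ D.Adj x.1 z ∧ D.Adj y.1 z

/-- **THE VALUE OF THE HUNG `K_{4,k−5}`:** for `10 ≤ k`, a `HungK4` graph has `4 (k − 4) − 2` edges,
`Σ_v d(v)² + 2 (k − 3) + 2 (k − 9) = m k`, and is a spanning subgraph of no `K(A, Aᶜ)`. -/
theorem hungK4_value (D : SimpleGraph V) [DecidableRel D.Adj] (hk : 10 ≤ Fintype.card V) (hH : HungK4 D) :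
    D.edgeFinset.card + 2 = 4 * (Fintype.card V - 4) ∧
      ∑ v, deg D v * deg D v + 2 * (Fintype.card V - 3) + 2 * (Fintype.card V - 9) =
        D.edgeFinset.card * Fintype.card V ∧
      ∀ B : Finset V, ¬ BipSub D B := by
  obtain ⟨z, A, hz, hA, hB, hE, x, y, hxA, hyA, hxz, hyz⟩ := hH
  have hcard' := card_del z
  have hedges' := card_edges_del D z
  have hsq := sum_deg_sq_del D z
  rw [hz] at hedges' hsq
  have hxy : x ≠ y := fun h => hyA (h ▸ hxA)
  have hxyadj : (del D z).Adj x y := adj_of_bipSub_full (del D z) A hB 4 hA hE hxA hyA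
  have hdx := deg_of_bipSub_full (del D z) A hB 4 hA hE x
  have hdy := deg_of_bipSub_full (del D z) A hB 4 hA hE y
  rw [if_pos hxA] at hdx
  rw [if_neg hyA] at hdy
  have hT : ∑ w : {v : V // v ≠ z}, (if D.Adj w.1 z then deg (del D z) w else 0) =
      Fintype.card {v : V // v ≠ z} - 4 + 4 := by
    rw [← sum_filter, nbhd_del_eq_pair D z hz x y hxy hxz hyz, sum_pair hxy, hdx, hdy]
  haveI : Nonempty {v : V // v ≠ z} := Fintype.card_pos_iff.mp (by omega)
  have hS' := sum_deg_sq_eq_of_bipSub_full (del D z) A 4 hA hB hE inferInstance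
  refine ⟨by omega, ?_, ?_⟩
  · rw [hsq, hT, hS', hE]
    obtain ⟨k, hk'⟩ : ∃ k, Fintype.card V = k := ⟨_, rfl⟩
    have e : Fintype.card {v : V // v ≠ z} = k - 1 := by omega
    rw [hE, e] at hedges'
    rw [e, hk']
    obtain ⟨t, rfl⟩ : ∃ t, k = t + 10 := ⟨k - 10, by omega⟩
    have e1 : t + 10 - 1 - 4 = t + 5 := by omega
    have e2 : t + 10 - 1 = t + 9 := by omega
    have e3 : t + 10 - 3 = t + 7 := by omega
    have e4 : t + 10 - 9 = t + 1 := by omega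
    rw [e1, e2, e3, e4]
    rw [e1] at hedges'
    have : D.edgeFinset.card = 4 * (t + 5) + 2 := by omega
    rw [this]
    ring
  · intro B hBip
    have h1 := hBip x.1 z hxz
    have h2 := hBip y.1 z hyz
    have h3 := hBip x.1 y.1 (by
      have := hxyadj
      unfold del at this
      exact this)
    tauto

/-- **THE CAP ON THE CELL `(k, 4, 2)` WITH EVERY DEGREE `≥ 4`, `k ≥ 11`:** a vertex `x` of degree `k − 4` makes `D`
`4`-bipartite (the one-triangle structure `M = 1` needs a vertex of degree `2`). -/
theorem four_two_cap_strict (D : SimpleGraph V) [DecidableRel D.Adj] (hK : K4mFree D)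
    (hk : 11 ≤ Fintype.card V) (hm : D.edgeFinset.card + 2 = 4 * (Fintype.card V - 4))
    (hdeg4 : ∀ v, 4 ≤ deg D v) (x : V) (hx : deg D x + 4 = Fintype.card V) :
    ∃ A : Finset V, A.card = 4 ∧ BipSub D A := by
  obtain ⟨N, hN⟩ : ∃ N : Finset V, N = univ.filter (fun w => D.Adj x w) := ⟨_, rfl⟩
  have hmemN : ∀ w, w ∈ N ↔ D.Adj x w := fun w => by rw [hN, mem_filter]; simp only [mem_univ, true_and]
  have hxN : x ∉ N := fun h => D.irrefl ((hmemN x).mp h)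
  have hdx : deg D x = N.card := by rw [hN]; rfl
  obtain ⟨K, hKdef⟩ : ∃ K, N.card = K := ⟨_, rfl⟩
  have hcardV : Fintype.card V = K + 4 := by omega
  obtain ⟨m, hmdef⟩ : ∃ m, D.edgeFinset.card = m := ⟨_, rfl⟩
  rw [hmdef, hcardV, Nat.add_sub_cancel] at hm
  obtain ⟨R, hR⟩ : ∃ R : Finset V, R = (insert x N)ᶜ := ⟨_, rfl⟩
  have hRcard : R.card = 3 := by
    rw [hR, card_compl, card_insert_of_notMem hxN]
    omega
  have hmemR : ∀ w, w ∈ R ↔ w ≠ x ∧ ¬ D.Adj x w := by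
    intro w
    rw [hR, mem_compl, mem_insert, hmemN]
    tauto
  obtain ⟨M, hM⟩ : ∃ M, adjPairs D N = 2 * M := ⟨_, adjPairs_eq_two_mul D N⟩
  have hTf : ∑ y ∈ N, degIn D N y = 2 * M := by rw [← adjPairs_eq_sum_degIn, hM]
  have hfle : ∀ y ∈ N, degIn D N y ≤ 1 := by
    intro y hy
    have h1 := degIn_nbhd_le_one D hK (x := x) (u := y) ((hmemN y).mp hy)
    rw [← hN] at h1
    exact h1
  obtain ⟨P, hPdef⟩ : ∃ P, ∑ u ∈ R, degIn D N u = P := ⟨_, rfl⟩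
  obtain ⟨E, hEdef⟩ : ∃ E, adjPairs D R = E := ⟨_, rfl⟩
  have hsplit : ∀ F : V → ℕ, ∑ w, F w = F x + ∑ y ∈ N, F y + ∑ u ∈ R, F u := by
    intro F
    rw [← sum_add_sum_compl (insert x N), sum_insert hxN, ← hR]
  have hdegN : ∀ y ∈ N, deg D y = 1 + degIn D N y + degIn D R y := by
    intro y hy
    have := deg_eq_of_mem_nbhd D x y ((hmemN y).mp hy)
    rw [← hN, ← hR] at this
    exact this
  have hsumN : ∑ y ∈ N, deg D y = K + 2 * M + P := by
    rw [sum_congr rfl hdegN, sum_add_distrib, sum_add_distrib, sum_const, smul_eq_mul, mul_one, hKdef, hTf,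
      sum_degIn_comm D N R, hPdef]
  have hdegR : ∀ u ∈ R, deg D u = degIn D N u + degIn D R u := by
    intro u hu
    have := deg_eq_of_not_mem_nbhd D x u ((hmemR u).mp hu).2
    rw [← hN, ← hR] at this
    exact this
  have hsumR : ∑ u ∈ R, deg D u = P + E := by
    rw [sum_congr rfl hdegR, sum_add_distrib, hPdef, ← adjPairs_eq_sum_degIn, hEdef]
  have hdegsum := sum_deg_eq D
  rw [hsplit, hsumN, hsumR, hdx, hKdef, hmdef] at hdegsum
  have hPle : ∀ u ∈ R, degIn D N u + M ≤ K := by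
    intro u hu
    have := two_mul_degIn_add_adjPairs_le D hK (x := x) ((hmemR u).mp hu).1
    rw [← hN, hM, hKdef] at this
    omega
  have h2 : P + 3 * M ≤ 3 * K := by
    have hs : ∑ u ∈ R, (degIn D N u + M) ≤ ∑ _u ∈ R, K := sum_le_sum hPle
    rw [sum_add_distrib, sum_const, sum_const, smul_eq_mul, smul_eq_mul, hPdef, hRcard] at hs
    exact hs
  have hE6 : E ≤ 6 := by
    have := adjPairs_le_card_mul_pred D R
    rw [hEdef, hRcard] at this
    exact this
  have hnoedge : 1 ≤ E → P + M ≤ 2 * K + 1 := by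
    intro hE
    obtain ⟨u, hu, hu1⟩ : ∃ u ∈ R, 1 ≤ degIn D R u := by
      by_contra hcon
      push Not at hcon
      have h0 : ∑ u ∈ R, degIn D R u = 0 := sum_eq_zero (fun u hu => by have := hcon u hu; omega)
      rw [← adjPairs_eq_sum_degIn, hEdef] at h0
      omega
    obtain ⟨v, hv, huv⟩ : ∃ v ∈ R, D.Adj u v := by
      unfold degIn at hu1
      obtain ⟨v, hv⟩ := card_pos.mp hu1
      rw [mem_filter] at hv
      exact ⟨v, hv.1, hv.2⟩
    have hne : u ≠ v := D.ne_of_adj huv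
    have hPuv : degIn D N u + degIn D N v ≤ K + 1 := by
      have := degIn_add_degIn_le_of_adj_pair D hK N huv
      rw [hKdef] at this
      exact this
    have hvR' : v ∈ R.erase u := mem_erase.mpr ⟨hne.symm, hv⟩
    have hsum1 := add_sum_erase R (fun w => degIn D N w) hu
    have hsum2 := add_sum_erase (R.erase u) (fun w => degIn D N w) hvR'
    have hcard2 : ((R.erase u).erase v).card = 1 := by
      rw [card_erase_of_mem hvR', card_erase_of_mem hu]
      omega
    have hrest : ∑ w ∈ (R.erase u).erase v, degIn D N w + M ≤ K := by
      have hs : ∑ w ∈ (R.erase u).erase v, (degIn D N w + M) ≤ ∑ _w ∈ (R.erase u).erase v, K :=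
        sum_le_sum (fun w hw => hPle w (mem_of_mem_erase (mem_of_mem_erase hw)))
      rw [sum_add_distrib, sum_const, sum_const, smul_eq_mul, smul_eq_mul, hcard2, one_mul, one_mul] at hs
      exact hs
    rw [hPdef] at hsum1
    omega
  obtain ⟨hE0, hM1⟩ := four_cap_count K M P E m hdegsum hm h2 hE6 (by omega) hnoedge
  have hnoR : ∀ u ∈ R, degIn D R u = 0 := by
    intro u hu
    have hle : degIn D R u ≤ ∑ z ∈ R, degIn D R z := single_le_sum (fun _ _ => Nat.zero_le _) hu
    rw [← adjPairs_eq_sum_degIn, hEdef, hE0] at hle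
    exact Nat.le_zero.mp hle
  -- `M = 1` is impossible with every degree `≥ 4`
  have hM0 : M = 0 := by
    by_contra hMne
    have hM1' : M = 1 := by omega
    -- a matched vertex `y`
    obtain ⟨y, hy, hfy⟩ : ∃ y ∈ N, 1 ≤ degIn D N y := by
      by_contra hcon
      push Not at hcon
      have h0 : ∑ y ∈ N, degIn D N y = 0 := sum_eq_zero (fun y hy => by have := hcon y hy; omega)
      rw [hTf, hM1'] at h0
      omega
    obtain ⟨y', hy'N, hyy'⟩ : ∃ y' ∈ N, D.Adj y y' := by
      unfold degIn at hfy
      obtain ⟨y', hy'⟩ := card_pos.mp hfy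
      rw [mem_filter] at hy'
      exact ⟨y', hy'.1, hy'.2⟩
    have hpair := degIn_add_degIn_le_card_of_nbhd_edge D hK x R (fun u hu => ((hmemR u).mp hu).1)
      ((hmemN y).mp hy) ((hmemN y').mp hy'N) hyy'
    rw [hRcard] at hpair
    have h4 := hdeg4 y
    have h4' := hdeg4 y'
    rw [hdegN y hy] at h4
    rw [hdegN y' hy'N] at h4'
    have hf := hfle y hy
    have hf' := hfle y' hy'N
    omega
  -- no edge inside `N`, none inside `R`: `D ⊆ K(Nᶜ, N)`
  have hnoN : ∀ y ∈ N, ∀ y', D.Adj y y' → y' ∉ N := by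
    intro y hy y' hyy' hy'
    have h0 : degIn D N y = 0 := by
      have hle : degIn D N y ≤ ∑ z ∈ N, degIn D N z := single_le_sum (fun _ _ => Nat.zero_le _) hy
      rw [hTf, hM0, mul_zero] at hle
      exact Nat.le_zero.mp hle
    unfold degIn at h0
    rw [card_eq_zero, filter_eq_empty_iff] at h0
    exact h0 hy' hyy'
  have hnoR' : ∀ u ∈ R, ∀ u', D.Adj u u' → u' ∉ R := by
    intro u hu u' huu' hu'
    have h0 := hnoR u hu
    unfold degIn at h0
    rw [card_eq_zero, filter_eq_empty_iff] at h0
    exact h0 hu' huu'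
  refine ⟨Nᶜ, ?_, ?_⟩
  · rw [card_compl, hKdef]
    omega
  · intro p q hpq
    rw [mem_compl, mem_compl, not_not]
    constructor
    · intro hpN
      by_contra hqN
      by_cases hpx : p = x
      · subst hpx
        exact hqN ((hmemN q).mpr hpq)
      by_cases hqx : q = x
      · subst hqx
        exact hpN ((hmemN p).mpr (D.adj_symm hpq))
      have hpR : p ∈ R := (hmemR p).mpr ⟨hpx, fun h => hpN ((hmemN p).mpr h)⟩
      have hqR : q ∈ R := (hmemR q).mpr ⟨hqx, fun h => hqN ((hmemN q).mpr h)⟩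
      exact hnoR' p hpR q hpq hqR
    · intro hqN hpN
      exact hnoN p hpN q hpq hqN

end C047

end TriangleCap

end PercRepro
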